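import Mathlib
import HarnessLib
import Literature.Computability.AlgebraicComplexity.ArithCircuit
import Literature.Computability.AlgebraicComplexity.CircuitDepth
import Literature.Computability.AlgebraicComplexity.StandardFamilies
import Literature.Computability.AlgebraicComplexity.DeterminantalIdealComplexityDescent
import Literature.Computability.AlgebraicComplexity.RealTauConjectureDepthFour
import Literature.Computability.AlgebraicComplexity.AndrewsForbes2022BorderComposition
import Summits.ValiantsHypothesis.Statement

/-!
# SuccinctLift — algebraic constants suffice at a FIXED skeleton (wall K, transcendental half)

Route `route-ValiantsHypothesis-SuccinctLift` (lens 2 of the Valiant decomposition workshop) factors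
lens-4's `PerHardLog3` as `A ∧ U ∧ K`, where the constant wall
`K = ConstantLiftLog3 : PerHardLog3CF → PerHardLog3` asks to remove ARBITRARY complex constants from
a product-depth-`Δ₁(n) = ⌊log₂⌊log₂⌊log₂ n⌋⌋⌋+1`, poly-wire circuit family for the permanent.

This file discharges, in the kernel, the TRANSCENDENTAL half of that wall: a complex circuit
computing a rational polynomial can be replaced by a circuit with constants in the relative
algebraic closure `Q̄ = algebraicClosure ℚ ℂ` having the IDENTICAL skeleton — same gates, same
wires, same product-depth, same size — and computing the same polynomial
(`exists_algebraicConstants`). Proof (Bürgisser 2000, §4.1 "VP_k = VNP_k only depends on the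
algebraic closure of the prime field", made skeleton-exact): replace the finitely many constants
`γ` of `C` by indeterminates `X_γ` (`ArithCircuit.mapConsts`), so the generic circuit `C̃` over
`A = ℚ[X_γ]` specialises back to `C` along `X_γ ↦ γ` (`map_mapConsts_eq_self`); the coefficients of
`C̃.eval − f` lie in the kernel of that specialisation, hence in a maximal ideal `M` above it; the
residue field `A ⧸ M` is finite over `ℚ` (Zariski's lemma, `finite_of_finite_type_of_isJacobsonRing`)
and embeds into `ℂ` (`IsAlgClosed.lift`) with algebraic image; specialising `C̃` along
`A → A ⧸ M → Q̄` gives the wanted circuit. Consequently the depth-`Δ`, `n^c + c`-wire statement for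
`per` over `ℂ` and over `Q̄` are EQUIVALENT for every depth function `Δ`
(`perInDepthPoly_iff_algebraic`), and wall K is equivalent to its algebraic-constant form
`K_alg : PerHardLog3CF → PerHardLog3Alg` (`constantLiftLog3_iff_alg`, stated on the route's inlined
items): what remains of K is ALGEBRAIC-constant elimination at fixed product depth
(Bürgisser 2000 Ch. 4; Koiran 2004), nothing transcendental.

References: Burgisser2000 (§4.1, Prop. 4.1(c)); Koiran2004; KoiranPerifel2011.
-/

namespace Summit.ValiantsHypothesis.ValiantsHypothesis.Theorems.SuccinctLift

open Literature.Computability.AlgebraicComplexity MvPolynomial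

/-- **Algebraic constants suffice at a fixed skeleton** (Bürgisser 2000, §4.1, skeleton-exact form):
a complex arithmetic circuit computing (the image of) a rational polynomial `f` can be replaced by
a circuit over `algebraicClosure ℚ ℂ` with the same product-depth, the same edge size and the same
size, computing `f`. [cite: Burgisser2000, §4.1] -/
theorem exists_algebraicConstants {σ : Type*} (C : ArithCircuit ℂ σ) (f : MvPolynomial σ ℚ)
    (hC : C.Computes (MvPolynomial.map (algebraMap ℚ ℂ) f)) :
    ∃ C₀ : ArithCircuit (algebraicClosure ℚ ℂ) σ,
      C₀.Computes (MvPolynomial.map (algebraMap ℚ (algebraicClosure ℚ ℂ)) f) ∧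
      C₀.productDepth = C.productDepth ∧ C₀.edgeSize = C.edgeSize ∧ C₀.size = C.size := by
  classical
  -- Step 1: the generic circuit over `A₀ = ℚ[X_γ : γ a constant of C]`.
  let S : Finset ℂ := C.consts.toFinset
  let A₀ : Type := MvPolynomial (↥S) ℚ
  let ρ : ℂ → A₀ := fun z => if h : z ∈ S then X ⟨z, h⟩ else 0
  let ψ₀ : A₀ →ₐ[ℚ] ℂ := aeval (fun s : ↥S => (s : ℂ))
  let Ct : ArithCircuit A₀ σ := C.mapConsts ρ
  have hfix : ∀ c ∈ C.consts, ψ₀.toRingHom (ρ c) = c := by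
    intro c hc
    have hcS : c ∈ S := List.mem_toFinset.mpr hc
    show ψ₀ (ρ c) = c
    simp only [ρ, dif_pos hcS, ψ₀]
    exact aeval_X _ _
  have hCt : Ct.map ψ₀.toRingHom = C := ArithCircuit.map_mapConsts_eq_self ρ ψ₀.toRingHom C hfix
  -- Step 2: Zariski's lemma — a maximal ideal above the kernel of the specialisation has an
  -- algebraic residue field, which embeds into `ℂ` inside `Q̄`.
  obtain ⟨M, hM, hKM⟩ := Ideal.exists_le_maximal (RingHom.ker ψ₀.toRingHom)
    (RingHom.ker_ne_top ψ₀.toRingHom)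
  let L := A₀ ⧸ M
  letI : Field L := Ideal.Quotient.field M
  haveI : Algebra.FiniteType ℚ L :=
    Algebra.FiniteType.of_surjective (Ideal.Quotient.mkₐ ℚ M) (Ideal.Quotient.mkₐ_surjective ℚ M)
  haveI : Module.Finite ℚ L := finite_of_finite_type_of_isJacobsonRing ℚ L
  haveI : Algebra.IsAlgebraic ℚ L := Algebra.IsAlgebraic.of_finite ℚ L
  let ψ : L →ₐ[ℚ] ℂ := IsAlgClosed.lift
  let θ : A₀ →+* ℂ := ψ.toRingHom.comp (Ideal.Quotient.mk M)
  have hθalg : ∀ a, θ a ∈ algebraicClosure ℚ ℂ := fun a =>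
    mem_algebraicClosure_iff.mpr
      ((Algebra.IsAlgebraic.isAlgebraic (R := ℚ) (Ideal.Quotient.mk M a)).algHom ψ)
  let θ₀ : A₀ →+* (algebraicClosure ℚ ℂ) := θ.codRestrict (algebraicClosure ℚ ℂ) hθalg
  have hcomp : (algebraMap (algebraicClosure ℚ ℂ) ℂ).comp θ₀ = θ := RingHom.ext fun a => rfl
  have hι : Function.Injective (algebraMap (algebraicClosure ℚ ℂ) ℂ) :=
    fun a b h => Subtype.ext h
  -- Step 3: the coefficients of `Ct.eval - f` die in `A₀ ⧸ M`, so `θ` maps `Ct.eval` to `f`.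
  have hevC : MvPolynomial.map ψ₀.toRingHom Ct.eval = MvPolynomial.map (algebraMap ℚ ℂ) f := by
    rw [← ArithCircuit.eval_map_apply, hCt]; exact hC
  have hevF : MvPolynomial.map ψ₀.toRingHom (MvPolynomial.map (algebraMap ℚ A₀) f) =
      MvPolynomial.map (algebraMap ℚ ℂ) f := by
    rw [MvPolynomial.map_map, AlgHom.toRingHom_eq_coe, AlgHom.comp_algebraMap]
  have hD : MvPolynomial.map (Ideal.Quotient.mk M)
      (Ct.eval - MvPolynomial.map (algebraMap ℚ A₀) f) = 0 := by
    ext m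
    rw [coeff_map, coeff_zero, Ideal.Quotient.eq_zero_iff_mem]
    apply hKM
    rw [RingHom.mem_ker, ← coeff_map, map_sub, hevC, hevF, sub_self, coeff_zero]
  have hθev : MvPolynomial.map θ Ct.eval = MvPolynomial.map (algebraMap ℚ ℂ) f := by
    have h1 : MvPolynomial.map θ (Ct.eval - MvPolynomial.map (algebraMap ℚ A₀) f) = 0 := by
      rw [show θ = ψ.toRingHom.comp (Ideal.Quotient.mk M) from rfl, ← MvPolynomial.map_map, hD,
        map_zero]
    rw [map_sub, sub_eq_zero, MvPolynomial.map_map] at h1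
    rw [h1, Subsingleton.elim (θ.comp (algebraMap ℚ A₀)) (algebraMap ℚ ℂ)]
  -- Step 4: the skeleton is untouched.
  have hpd : Ct.productDepth = C.productDepth := by
    conv_rhs => rw [← hCt]
    exact (ArithCircuit.productDepth_mapCoeff ψ₀.toRingHom Ct).symm
  have hes : Ct.edgeSize = C.edgeSize := by
    conv_rhs => rw [← hCt]
    exact (ArithCircuit.edgeSize_mapCoeff ψ₀.toRingHom Ct).symm
  have hsz : Ct.size = C.size := by
    conv_rhs => rw [← hCt]
    exact (ArithCircuit.size_map ψ₀.toRingHom Ct).symm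
  refine ⟨Ct.map θ₀, ?_, ?_, ?_, ?_⟩
  · refine MvPolynomial.map_injective (algebraMap (algebraicClosure ℚ ℂ) ℂ) hι ?_
    rw [ArithCircuit.eval_map_apply, MvPolynomial.map_map, MvPolynomial.map_map, hcomp, hθev,
      Subsingleton.elim ((algebraMap (algebraicClosure ℚ ℂ) ℂ).comp
        (algebraMap ℚ (algebraicClosure ℚ ℂ))) (algebraMap ℚ ℂ)]
  · rw [ArithCircuit.productDepth_mapCoeff, hpd]
  · rw [ArithCircuit.edgeSize_mapCoeff, hes]
  · rw [ArithCircuit.size_map, hsz]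

/-- Easy converse bookkeeping: a circuit over `Q̄ ⊂ ℂ` is a complex circuit with the same skeleton
(change of scalars along the inclusion). [cite: Burgisser2000, §4.1] -/
theorem computes_map_algebraic {σ : Type*} (C₀ : ArithCircuit (algebraicClosure ℚ ℂ) σ)
    (f : MvPolynomial σ ℚ)
    (h₀ : C₀.Computes (MvPolynomial.map (algebraMap ℚ (algebraicClosure ℚ ℂ)) f)) :
    (C₀.map (algebraMap (algebraicClosure ℚ ℂ) ℂ)).Computes (MvPolynomial.map (algebraMap ℚ ℂ) f) ∧
      (C₀.map (algebraMap (algebraicClosure ℚ ℂ) ℂ)).productDepth = C₀.productDepth ∧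
      (C₀.map (algebraMap (algebraicClosure ℚ ℂ) ℂ)).edgeSize = C₀.edgeSize := by
  refine ⟨?_, ArithCircuit.productDepth_mapCoeff _ _, ArithCircuit.edgeSize_mapCoeff _ _⟩
  have := h₀.map (algebraMap (algebraicClosure ℚ ℂ) ℂ)
  rwa [MvPolynomial.map_map, Subsingleton.elim ((algebraMap (algebraicClosure ℚ ℂ) ℂ).comp
    (algebraMap ℚ (algebraicClosure ℚ ℂ))) (algebraMap ℚ ℂ)] at this

/-- **Depth-`Δ` poly-wire circuits for the permanent: `ℂ` versus `Q̄`.** For every product-depth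
function `Δ`, per has `n^c + c`-wire, product-depth-`Δ(n)` circuits over `ℂ` iff it has them over
`algebraicClosure ℚ ℂ` (same `c`). The `→` direction is `exists_algebraicConstants`; `←` is change
of scalars. [cite: Burgisser2000, §4.1] -/
theorem perInDepthPoly_iff_algebraic (Δ : ℕ → ℕ) :
    (∃ c : ℕ, ∀ n : ℕ, ∃ C : ArithCircuit ℂ (Fin n × Fin n),
      C.Computes (perPoly (Fin n) ℂ) ∧ C.productDepth ≤ Δ n ∧ C.edgeSize ≤ n ^ c + c) ↔
    (∃ c : ℕ, ∀ n : ℕ, ∃ C : ArithCircuit (algebraicClosure ℚ ℂ) (Fin n × Fin n),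
      C.Computes (perPoly (Fin n) (algebraicClosure ℚ ℂ)) ∧ C.productDepth ≤ Δ n ∧
        C.edgeSize ≤ n ^ c + c) := by
  constructor
  · rintro ⟨c, hc⟩
    refine ⟨c, fun n => ?_⟩
    obtain ⟨C, hC, hd, hs⟩ := hc n
    obtain ⟨C₀, h₀, hd₀, hs₀, -⟩ :=
      exists_algebraicConstants C (perPoly (Fin n) ℚ) (by rwa [map_perPoly])
    exact ⟨C₀, by rwa [map_perPoly] at h₀, by rw [hd₀]; exact hd, by rw [hs₀]; exact hs⟩
  · rintro ⟨c, hc⟩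
    refine ⟨c, fun n => ?_⟩
    obtain ⟨C₀, h₀, hd, hs⟩ := hc n
    obtain ⟨h, hd', hs'⟩ :=
      computes_map_algebraic C₀ (perPoly (Fin n) ℚ) (by rwa [map_perPoly])
    exact ⟨C₀.map (algebraMap (algebraicClosure ℚ ℂ) ℂ), by rwa [map_perPoly] at h,
      by rw [hd']; exact hd, by rw [hs']; exact hs⟩

/-- **Wall K ⟺ its algebraic-constant form K_alg**, on the route's inlined items
(`Δ₁(n) = ⌊log₂⌊log₂⌊log₂ n⌋⌋⌋ + 1`): `ConstantLiftLog3` (constant-free hardness ⇒ hardness against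
arbitrary complex constants) is equivalent to `AlgConstantLiftLog3` (constant-free hardness ⇒
hardness against constants in `algebraicClosure ℚ ℂ`). The transcendental part of constant
elimination at fixed product depth is thereby DISCHARGED; the residual wall is algebraic-constant
elimination (Bürgisser 2000, Ch. 4; Koiran 2004). [cite: Burgisser2000, §4.1 and Ch. 4] -/
theorem constantLiftLog3_iff_alg (H : Prop) :
    (H → ¬ ∃ c : ℕ, ∀ n : ℕ, ∃ C : ArithCircuit ℂ (Fin n × Fin n),
      C.Computes (perPoly (Fin n) ℂ) ∧ C.productDepth ≤ Nat.log 2 (Nat.log 2 (Nat.log 2 n)) + 1 ∧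
        C.edgeSize ≤ n ^ c + c) ↔
    (H → ¬ ∃ c : ℕ, ∀ n : ℕ, ∃ C : ArithCircuit (algebraicClosure ℚ ℂ) (Fin n × Fin n),
      C.Computes (perPoly (Fin n) (algebraicClosure ℚ ℂ)) ∧
        C.productDepth ≤ Nat.log 2 (Nat.log 2 (Nat.log 2 n)) + 1 ∧ C.edgeSize ≤ n ^ c + c) := by
  rw [perInDepthPoly_iff_algebraic (fun n => Nat.log 2 (Nat.log 2 (Nat.log 2 n)) + 1)]

end Summit.ValiantsHypothesis.ValiantsHypothesis.Theorems.SuccinctLift
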